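import Literature.AnabelianGeometry.SemiGraphs.PSCConjClassLevelwiseProofs
import HarnessLib

/-!
# [CombGC] Thm. 1.6 (i)(ii): "`α` induces a functorial bijection between the sets of vertices [cusps]
# of `G`, `H`" ⇒ `α` is group-theoretically verticial [cuspidal] — the vertex SETS of the coverings

Mochizuki, *A combinatorial version of the Grothendieck conjecture*, Tohoku Math. J. **59** (2007) [CombGC],
proof of Theorem 1.6, author's ms p. 13 l.−9 – −7 ("Since the cuspidal edge-like subgroups may be
recovered as the stabilizers of cusps of finite étale coverings of `G`, `H`, it suffices to show that `α`
induces a functorial bijection between the sets of cusps of `G`, `H`") and p. 14 l.25–28 ("to prove that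
`α` is group-theoretically verticial, it suffices to prove [cf. the proof of assertion (i)] that `α`
induces a functorial bijection between the sets of vertices of `G`, `H`"), render `paper:url-6994f81053dc`
p0013–p0014.  [cite: MochizukiCombGC2007, Thm 1.6(ii) p.14]

PROOF-ONLY file (abc-iut cell, layer L3, `plan/L3/SUBDAG-CombGC-Thm16.md`, support row under T16-L09b
(descent from the compactifications) / T16-L06 (descent from finite étale coverings); sequel to
`PSCConjClassLevelwiseProofs.lean` (p420865: group-theoretic verticiality is recognised level-wise on the
STABILIZERS `U ⊔ Π_v^γ`).  Here the stabilizers are identified with the VERTICES themselves.  Over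
abc-iut-L3-t4's interface (`PSCDatum Π`): the vertices of the covering `G_U` (open normal `U ≤ Π_G`) lying
over the vertex `v` are the double cosets `U γ Π_v` (`DoubleCoset.Quotient U Π_v`; abc-iut-L3-t4's
`PSCCoveringDatum.dcEnum` enumerates exactly this type), the Galois group `Π_G / U` acting by LEFT
multiplication; generic over a finite family `S : ι → Subgroup Π` of closed subgroups (vertices: `vertGp`;
cusps: `cuspGp`; …):

* `mk_mul_eq_mk_iff` — the STABILIZER in `Π` of the vertex `U x Π_v` of `G_U` is `U ⊔ Π_v^x = U · x Π_v x⁻¹`;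
* `stabilizers_correspond_of_equivariant_bijection` — if `e_U : Vert(G_U) ≃ Vert(H_{U'})`, `U' = α(U)`,
  is a bijection of the vertex sets that is EQUIVARIANT along `α` for the Galois actions (the level-`U`
  instance of "`α` induces a functorial bijection between the sets of vertices", functoriality with
  respect to the Galois group of the covering), then for every `V ≥ U`: `V` is a vertex stabilizer
  `U ⊔ Π_v^γ` of `G_U` iff `α(V)` is a vertex stabilizer `U' ⊔ Π_w^δ` of `H_{U'}`;
* **`transport_of_equivariant_bijections`** / **`isGroupTheoreticallyVerticial_of_vertex_bijections`** /
  **`isGroupTheoreticallyCuspidal_of_cusp_bijections`** — hence, for profinite `Π_G`, `Π_H`: if at EVERY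
  level `U` such an `α`-equivariant bijection of vertex [cusp] sets exists, then `α` is group-theoretically
  verticial [cuspidal] (Def. 1.4 (iv)) — by p420865 `transport_iff_levelwise`.
No compatibility between the bijections at different levels is needed (p420865 extracts the coherence by
compactness).  Pure group theory over the interface; no definitions; no statement of [CombGC] is asserted;
nothing here takes a side on [IUTchIII] Cor. 3.12.
-/

noncomputable section

namespace Literature.AnabelianGeometry.SemiGraphs

namespace PSCDatum

open scoped Pointwise

universe u

variable {P : Type u} [Group P] [TopologicalSpace P]
variable {P' : Type u} [Group P'] [TopologicalSpace P']

/-! ### 1. Stabilizers of the vertices `U x Π_v` of `G_U` -/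

omit [TopologicalSpace P] in
/-- **The stabilizer of the vertex `U x Π_v` of the covering `G_U`** under the action of `Π_G` (through
`Π_G/U`) by left multiplication on the double cosets `U \ Π_G / Π_v` is `U ⊔ Π_v^x = U · x Π_v x⁻¹`:
`U (g x) Π_v = U x Π_v ↔ g ∈ U ⊔ x • Π_v` (`U` normal). [cite: MochizukiCombGC2007, Thm 1.6(ii) p.14] -/
theorem mk_mul_eq_mk_iff {U : Subgroup P} (hU : U.Normal) (K : Subgroup P) (g x : P) :
    DoubleCoset.mk U K (g * x) = DoubleCoset.mk U K x ↔ g ∈ U ⊔ ConjAct.toConjAct x • K := by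
  haveI := hU
  have hmem : ∀ y : P, y ∈ U ⊔ ConjAct.toConjAct x • K ↔
      ∃ u ∈ U, ∃ k ∈ K, y = u * (x * k * x⁻¹) := by
    intro y
    rw [← SetLike.mem_coe, Subgroup.normal_mul, Set.mem_mul]
    constructor
    · rintro ⟨u, hu, z, hz, rfl⟩
      rw [SetLike.mem_coe, Subgroup.mem_smul_pointwise_iff_exists] at hz
      obtain ⟨k, hk, rfl⟩ := hz
      exact ⟨u, hu, k, hk, by simp [ConjAct.smul_def, mul_assoc]⟩
    · rintro ⟨u, hu, k, hk, rfl⟩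
      refine ⟨u, hu, x * k * x⁻¹, ?_, rfl⟩
      rw [SetLike.mem_coe, Subgroup.mem_smul_pointwise_iff_exists]
      exact ⟨k, hk, by simp [ConjAct.smul_def, mul_assoc]⟩
  rw [DoubleCoset.eq, hmem]
  constructor
  · rintro ⟨u, hu, k, hk, h⟩
    -- `x = u * (g * x) * k` ⇒ `g = u⁻¹ * (x * k⁻¹ * x⁻¹)`
    refine ⟨u⁻¹, U.inv_mem hu, k⁻¹, K.inv_mem hk, ?_⟩
    have h' : g * x = u⁻¹ * x * k⁻¹ := by
      have := congrArg (fun t => u⁻¹ * t * k⁻¹) h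
      simpa [mul_assoc] using this.symm
    calc g = g * x * x⁻¹ := by group
      _ = u⁻¹ * x * k⁻¹ * x⁻¹ := by rw [h']
      _ = u⁻¹ * (x * k⁻¹ * x⁻¹) := by group
  · rintro ⟨u, hu, k, hk, rfl⟩
    refine ⟨u⁻¹, U.inv_mem hu, k⁻¹, K.inv_mem hk, ?_⟩
    group

/-! ### 2. An `α`-equivariant bijection of vertex sets matches the stabilizers -/

section OneLevel

variable (α : P ≃ₜ* P') {ι ι' : Type*} (S : ι → Subgroup P) (T : ι' → Subgroup P')

/-- Transfer of membership along `α`: `α g ∈ α(V) ↔ g ∈ V`. [cite: MochizukiCombGC2007, Def 1.4 p.10] -/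
private theorem map_mem_map_iff (V : Subgroup P) (g : P) :
    α g ∈ V.map α.toMulEquiv.toMonoidHom ↔ g ∈ V := by
  constructor
  · rintro ⟨g', hg', h⟩
    rwa [← α.injective h]
  · exact fun hg => ⟨g, hg, rfl⟩

/-- **An `α`-EQUIVARIANT bijection between the vertex sets of `G_U` and `H_{U'}` (`U' = α U`) matches
the vertex STABILIZERS**: if `e : Vert(G_U) ≃ Vert(H_{U'})` satisfies
`e(U (g x) Π_v) = α(g) · e(U x Π_v)` (functoriality of "the bijection induced by `α`" with respect to the
Galois groups `Π_G/U ≅ Π_H/U'`), then a subgroup `V ⊇ U` is a vertex stabilizer `U ⊔ Π_v^γ` of `G_U` if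
and only if `α(V)` is a vertex stabilizer `U' ⊔ Π_w^δ` of `H_{U'}`.  (Generic over families `S`, `T`:
vertices, cusps, nodes.) [cite: MochizukiCombGC2007, Thm 1.6(ii) p.14] -/
theorem stabilizers_correspond_of_equivariant_bijection {U : Subgroup P} (hU : U.Normal)
    {U' : Subgroup P'} (hU' : U'.Normal) (hUU' : U.map α.toMulEquiv.toMonoidHom = U')
    (e : (Σ i, DoubleCoset.Quotient (U : Set P) (S i : Set P)) ≃
      (Σ j, DoubleCoset.Quotient (U' : Set P') (T j : Set P')))
    (he : ∀ (g x : P) (i : ι) (j : ι') (y : P'),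
      e ⟨i, DoubleCoset.mk U (S i) x⟩ = ⟨j, DoubleCoset.mk U' (T j) y⟩ →
        e ⟨i, DoubleCoset.mk U (S i) (g * x)⟩ = ⟨j, DoubleCoset.mk U' (T j) (α g * y)⟩)
    (V : Subgroup P) (hUV : U ≤ V) :
    (∃ (i : ι) (γ : ConjAct P), V = U ⊔ γ • S i) ↔
      ∃ (j : ι') (δ : ConjAct P'),
        V.map α.toMulEquiv.toMonoidHom = U.map α.toMulEquiv.toMonoidHom ⊔ δ • T j := by
  rw [hUU']
  -- the key step: at a pair of corresponding vertices `U x S i ↦ U' y T j`, the stabilizers correspond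
  have key : ∀ (i : ι) (x : P) (j : ι') (y : P'),
      e ⟨i, DoubleCoset.mk U (S i) x⟩ = ⟨j, DoubleCoset.mk U' (T j) y⟩ → ∀ g : P,
        (g ∈ U ⊔ ConjAct.toConjAct x • S i ↔ α g ∈ U' ⊔ ConjAct.toConjAct y • T j) := by
    intro i x j y h0 g
    rw [← mk_mul_eq_mk_iff hU (S i) g x, ← mk_mul_eq_mk_iff hU' (T j) (α g) y]
    constructor
    · intro hgx
      have h1 := he g x i j y h0
      rw [hgx, h0] at h1
      exact (eq_of_heq (Sigma.mk.inj_iff.mp h1).2).symm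
    · intro hgy
      have h1 : e ⟨i, DoubleCoset.mk U (S i) (g * x)⟩ = e ⟨i, DoubleCoset.mk U (S i) x⟩ := by
        rw [he g x i j y h0, hgy, ← h0]
      exact eq_of_heq (Sigma.mk.inj_iff.mp (e.injective h1)).2
  constructor
  · rintro ⟨i, γ, rfl⟩
    set x : P := ConjAct.ofConjAct γ with hx
    rcases hq : e ⟨i, DoubleCoset.mk U (S i) x⟩ with ⟨j, q⟩
    set y : P' := q.out with hy
    have hqy : DoubleCoset.mk U' (T j) y = q := DoubleCoset.out_eq' _ _ q
    have h0 : e ⟨i, DoubleCoset.mk U (S i) x⟩ = ⟨j, DoubleCoset.mk U' (T j) y⟩ := by rw [hq, hqy]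
    refine ⟨j, ConjAct.toConjAct y, Subgroup.ext fun g' => ?_⟩
    obtain ⟨g, rfl⟩ := α.surjective g'
    rw [map_mem_map_iff α]
    have hγ : γ = ConjAct.toConjAct x := by rw [hx, ConjAct.toConjAct_ofConjAct]
    rw [hγ]
    exact key i x j y h0 g
  · rintro ⟨j, δ, hV⟩
    set y : P' := ConjAct.ofConjAct δ with hy
    rcases hq : e.symm ⟨j, DoubleCoset.mk U' (T j) y⟩ with ⟨i, q⟩
    set x : P := q.out with hx
    have hqx : DoubleCoset.mk U (S i) x = q := DoubleCoset.out_eq' _ _ q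
    have h0 : e ⟨i, DoubleCoset.mk U (S i) x⟩ = ⟨j, DoubleCoset.mk U' (T j) y⟩ := by
      rw [hqx, ← hq, Equiv.apply_symm_apply]
    refine ⟨i, ConjAct.toConjAct x, Subgroup.ext fun g => ?_⟩
    have hδ : δ = ConjAct.toConjAct y := by rw [hy, ConjAct.toConjAct_ofConjAct]
    rw [← map_mem_map_iff α V g]
    change α g ∈ V.map α.toMulEquiv.toMonoidHom ↔ g ∈ U ⊔ ConjAct.toConjAct x • S i
    rw [hV, hδ]
    exact (key i x j y h0 g).symm

end OneLevel

/-! ### 3. Equivariant vertex [cusp] bijections at every level ⇒ group-theoretically verticial [cuspidal] -/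

section AllLevels

variable [IsTopologicalGroup P] [CompactSpace P] [TotallyDisconnectedSpace P]
variable [IsTopologicalGroup P'] [CompactSpace P'] [TotallyDisconnectedSpace P']
variable (α : P ≃ₜ* P')

/-- **"`α` induces a functorial bijection between the sets of [`S`-objects] of the coverings" ⇒ `α`
transports the `S`-classes onto the `T`-classes** (generic form): for profinite `Π`, `Π'`, finite
closed families `S`, `T`, if at every level `U` (open normal, `U' := α U`) there is an `α`-equivariant
bijection between the `S`-objects `⨆_i U\Π/S i` of `G_U` and the `T`-objects of `H_{U'}`, then `α` carries
every conjugate of an `S i` to a conjugate of some `T j` and every such conjugate arises.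
[cite: MochizukiCombGC2007, Thm 1.6(ii) p.14] -/
theorem transport_of_equivariant_bijections {ι ι' : Type*} [Finite ι] [Finite ι'] (S : ι → Subgroup P)
    (hS : ∀ i, IsClosed ((S i : Subgroup P) : Set P)) (T : ι' → Subgroup P')
    (hT : ∀ j, IsClosed ((T j : Subgroup P') : Set P'))
    (h : ∀ U : Subgroup P, U.Normal → IsOpen (U : Set P) →
      ∃ e : (Σ i, DoubleCoset.Quotient (U : Set P) (S i : Set P)) ≃
          (Σ j, DoubleCoset.Quotient ((U.map α.toMulEquiv.toMonoidHom : Subgroup P') : Set P')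
            (T j : Set P')),
        ∀ (g x : P) (i : ι) (j : ι') (y : P'),
          e ⟨i, DoubleCoset.mk U (S i) x⟩ = ⟨j, DoubleCoset.mk (U.map α.toMulEquiv.toMonoidHom) (T j) y⟩ →
            e ⟨i, DoubleCoset.mk U (S i) (g * x)⟩ =
              ⟨j, DoubleCoset.mk (U.map α.toMulEquiv.toMonoidHom) (T j) (α g * y)⟩) :
    (∀ A : Subgroup P, (∃ (i : ι) (γ : ConjAct P), A = γ • S i) →
        ∃ (j : ι') (δ : ConjAct P'), A.map α.toMulEquiv.toMonoidHom = δ • T j) ∧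
      ∀ B : Subgroup P', (∃ (j : ι') (δ : ConjAct P'), B = δ • T j) →
        ∃ A : Subgroup P, (∃ (i : ι) (γ : ConjAct P), A = γ • S i) ∧
          A.map α.toMulEquiv.toMonoidHom = B := by
  refine (transport_iff_levelwise α S hS T hT).mpr fun U hUn hUo V hUV => ?_
  obtain ⟨e, he⟩ := h U hUn hUo
  exact stabilizers_correspond_of_equivariant_bijection α S T hUn
    (Subgroup.Normal.map hUn _ α.surjective) rfl e he V hUV

variable (G : PSCDatum P) (H : PSCDatum P')

/-- **[CombGC] p. 14 l.25–28, kernel form: "to prove that `α` is group-theoretically verticial, it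
suffices to prove that `α` induces a functorial bijection between the sets of vertices of `G`, `H`".**
For profinite `Π_G`, `Π_H`: if at every level `U` (open normal in `Π_G`, `U' := α U`) there is a bijection
`Vert(G_U) ≃ Vert(H_{U'})` of the vertex sets of the corresponding coverings (vertices over `v` = double
cosets `U γ Π_v`), equivariant along `α` for the Galois actions, then `α` is group-theoretically verticial.
[cite: MochizukiCombGC2007, Thm 1.6(ii) p.14] -/
theorem isGroupTheoreticallyVerticial_of_vertex_bijections
    (h : ∀ U : Subgroup P, U.Normal → IsOpen (U : Set P) →
      ∃ e : (Σ v, DoubleCoset.Quotient (U : Set P) (G.vertGp v : Set P)) ≃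
          (Σ w, DoubleCoset.Quotient ((U.map α.toMulEquiv.toMonoidHom : Subgroup P') : Set P')
            (H.vertGp w : Set P')),
        ∀ (g x : P) (v : G.graph.V) (w : H.graph.V) (y : P'),
          e ⟨v, DoubleCoset.mk U (G.vertGp v) x⟩ =
              ⟨w, DoubleCoset.mk (U.map α.toMulEquiv.toMonoidHom) (H.vertGp w) y⟩ →
            e ⟨v, DoubleCoset.mk U (G.vertGp v) (g * x)⟩ =
              ⟨w, DoubleCoset.mk (U.map α.toMulEquiv.toMonoidHom) (H.vertGp w) (α g * y)⟩) :
    G.IsGroupTheoreticallyVerticial H α := by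
  obtain ⟨h₁, h₂⟩ := transport_of_equivariant_bijections α G.vertGp G.isClosed_vertGp H.vertGp
    H.isClosed_vertGp h
  exact ⟨fun A ⟨v, γ, hA⟩ => by obtain ⟨w, δ, h'⟩ := h₁ A ⟨v, γ, hA⟩; exact ⟨w, δ, h'⟩,
    fun B ⟨w, δ, hB⟩ => by
      obtain ⟨A, ⟨v, γ, hA⟩, hAB⟩ := h₂ B ⟨w, δ, hB⟩; exact ⟨A, ⟨v, γ, hA⟩, hAB⟩⟩

/-- **[CombGC] p. 13 l.−9 – −7, kernel form: "since the cuspidal edge-like subgroups may be recovered as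
the stabilizers of cusps of finite étale coverings …, it suffices to show that `α` induces a functorial
bijection between the sets of cusps of `G`, `H`".**  If at every level there is an `α`-equivariant
bijection `Cusp(G_U) ≃ Cusp(H_{U'})`, then `α` is group-theoretically cuspidal.
[cite: MochizukiCombGC2007, Thm 1.6(i) p.13] -/
theorem isGroupTheoreticallyCuspidal_of_cusp_bijections
    (h : ∀ U : Subgroup P, U.Normal → IsOpen (U : Set P) →
      ∃ e : (Σ c, DoubleCoset.Quotient (U : Set P) (G.cuspGp c : Set P)) ≃
          (Σ c', DoubleCoset.Quotient ((U.map α.toMulEquiv.toMonoidHom : Subgroup P') : Set P')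
            (H.cuspGp c' : Set P')),
        ∀ (g x : P) (c : G.graph.C) (c' : H.graph.C) (y : P'),
          e ⟨c, DoubleCoset.mk U (G.cuspGp c) x⟩ =
              ⟨c', DoubleCoset.mk (U.map α.toMulEquiv.toMonoidHom) (H.cuspGp c') y⟩ →
            e ⟨c, DoubleCoset.mk U (G.cuspGp c) (g * x)⟩ =
              ⟨c', DoubleCoset.mk (U.map α.toMulEquiv.toMonoidHom) (H.cuspGp c') (α g * y)⟩) :
    G.IsGroupTheoreticallyCuspidal H α := by
  obtain ⟨h₁, h₂⟩ := transport_of_equivariant_bijections α G.cuspGp G.isClosed_cuspGp H.cuspGp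
    H.isClosed_cuspGp h
  exact ⟨fun A ⟨c, γ, hA⟩ => by obtain ⟨c', δ, h'⟩ := h₁ A ⟨c, γ, hA⟩; exact ⟨c', δ, h'⟩,
    fun B ⟨c', δ, hB⟩ => by
      obtain ⟨A, ⟨c, γ, hA⟩, hAB⟩ := h₂ B ⟨c', δ, hB⟩; exact ⟨A, ⟨c, γ, hA⟩, hAB⟩⟩

/-- Likewise for the edge sets (nodes ⊔ cusps): `α`-equivariant bijections `Edge(G_U) ≃ Edge(H_{U'})` at
every level ⇒ `α` group-theoretically edge-like. [cite: MochizukiCombGC2007, Thm 1.6(ii) p.14] -/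
theorem isGroupTheoreticallyEdgeLike_of_edge_bijections
    (h : ∀ U : Subgroup P, U.Normal → IsOpen (U : Set P) →
      ∃ e : (Σ c, DoubleCoset.Quotient (U : Set P) (G.edgeGp c : Set P)) ≃
          (Σ c', DoubleCoset.Quotient ((U.map α.toMulEquiv.toMonoidHom : Subgroup P') : Set P')
            (H.edgeGp c' : Set P')),
        ∀ (g x : P) (c : G.graph.N ⊕ G.graph.C) (c' : H.graph.N ⊕ H.graph.C) (y : P'),
          e ⟨c, DoubleCoset.mk U (G.edgeGp c) x⟩ =
              ⟨c', DoubleCoset.mk (U.map α.toMulEquiv.toMonoidHom) (H.edgeGp c') y⟩ →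
            e ⟨c, DoubleCoset.mk U (G.edgeGp c) (g * x)⟩ =
              ⟨c', DoubleCoset.mk (U.map α.toMulEquiv.toMonoidHom) (H.edgeGp c') (α g * y)⟩) :
    G.IsGroupTheoreticallyEdgeLike H α := by
  obtain ⟨h₁, h₂⟩ := transport_of_equivariant_bijections α G.edgeGp G.isClosed_edgeGp H.edgeGp
    H.isClosed_edgeGp h
  refine ⟨fun A hA => ?_, fun B hB => ?_⟩
  · obtain ⟨c, γ, hA'⟩ := (G.isEdgeLike_iff_exists_edgeGp A).mp hA
    obtain ⟨c', δ, h'⟩ := h₁ A ⟨c, γ, hA'⟩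
    exact (H.isEdgeLike_iff_exists_edgeGp _).mpr ⟨c', δ, h'⟩
  · obtain ⟨c', δ, hB'⟩ := (H.isEdgeLike_iff_exists_edgeGp B).mp hB
    obtain ⟨A, ⟨c, γ, hA⟩, hAB⟩ := h₂ B ⟨c', δ, hB'⟩
    exact ⟨A, (G.isEdgeLike_iff_exists_edgeGp A).mpr ⟨c, γ, hA⟩, hAB⟩

end AllLevels

end PSCDatum

end Literature.AnabelianGeometry.SemiGraphs
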